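import Literature.NumberTheory.EllipticCurves.GlobalMinimalModel
import Literature.NumberTheory.EllipticCurves.ModThreeReducibleIffPsi3Root
import Literature.NumberTheory.DiophantineGeometry.Conductor
import Mathlib.NumberTheory.Padics.PadicNumbers
import HarnessLib
import HarnessLib.Audit.Tags

/-!
# Candidate E-imc-71 `TypeThreeSubgroupCharacterUnramified` (imc g13d, MEMO-imc §19.15): at a Kodaira type III
# prime `3` (`9 ∥ N`, `v₃ Δ_min = 3`) a rational subgroup of order `3` has character UNRAMIFIED at `3` and is
# not `μ₃` — cell `bsd-f2-manin` (D-0131 (3) frontier: the Manin constant at additive primes)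

HONEST FRAMING. LENS = IMC / family-integrality (planner `bsd-f2-manin-imc`, planner-of-record, g13d; HOME
`run/shared/lean/pub/bsd-f2-manin/MEMO-imc.md` §19.15 «kernel-character law at a type III / III* prime 3»).
Source: HOME/imc/Sketch-imc-g13d.lean sha16 **e99357d621a1a96d** (farm rc 0), declarations `IsThreeSubgroupX`,
`threeSubgroupDisc`, `TypeThreeSubgroupCharacterUnramified`, `reducibleShallowIII_rationalLine_not_toric`
copied VERBATIM (namespace `BsdF2ManinImcG13d` ↦ `…ManinAdditive.TameThreeCharacter`; the sketch's route import
`…Theses.ManinLocalTwoThree` is NOT needed by these declarations and is dropped — leaf hygiene, no Theses in the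
cone), `@[conjecture]` added to the one law row; = refuter-1's row of record
`RefAudit60.TypeThreeSubgroupCharacterUnramified` (HOME/ref1-C60-tame3char-audit.lean 8b975c2d9ca3a379 §0a,
byte-identical body).  Filed ALONE on the planner-of-record's GO (imc g15, 2026-08-28T08:46:00Z): the sibling
rows E-imc-71* `TypeThreeStarSubgroupCharacterRamified`, E-imc-71u `TypeThreeSubgroupUnique`, E-imc-72
`TypeThreeStarOptimalNoThreeSubgroup` of the same sketch are KILLED AS TYPED by refuter-1 §R52 (selector leak:
`9 ∥ N ∧ v₃ Δ_min = 9` is III* ∪ I₃*, witnesses 1638t `[3,0,−728,0,0]` and 90c1) and are NOT filed; their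
repaired forms (`…PotGood`, refuter-1 C60 §3; 72′ = an's E-an-61, an OPEN global law) await re-typing by
the -imc and -an planners and a refuter pass.

THE ROW. `IsThreeSubgroupX W x₀`: `x₀` is a rational root of the `3`-division polynomial
`ψ₃ = 3x⁴ + b₂x³ + 3b₄x² + 3b₆x + b₈` (the `x`-coordinate of a ℚ-rational subgroup `ℓ` of order `3`);
`threeSubgroupDisc W x₀ = D₀ = ψ₂(x₀)² = 4x₀³ + b₂x₀² + 2b₄x₀ + b₆` (the points of `ℓ` are defined over `ℚ(√D₀)`,
Galois acts on `ℓ` through `χ_{D₀}`).  **E-imc-71**: on a global minimal model with `9 ∥ N` and `v₃ Δ_min = 3`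
— with the tree's Ogg-as-definition `f = v(Δ_min) + 1 − m` this selector is EXACTLY Kodaira type III at `3`
(m = 2; refuter-1 §R52: «safe», no potentially-good guard needed, contrast 71*) — every rational order-`3`
subgroup has `v₃(D₀)` EVEN (character unramified at `3`) and `−3·D₀` not a square (`ℓ ≇ μ₃`).  Census (BC5):
HOME/imc/g13-nec3_census.out, g13-nec3_companion.out, g13-nec3_typelevel.out (pure python, exact; Cremona
`N < 5·10⁵`, `9 ∥ N`): 8 650 / 8 650 type-III curves with a rational `ℓ` obey it (one subgroup each, quotient
III*).  WHY THE CELL WANTS IT (MEMO-imc §19.14 (OTA₃)/NEC₃, §20; crux C3 `ManinPrimeToThreeAtNine`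
stmt-BirchSwinnertonDyer-22968): the toric-type line `θ² = ω|_{I}` is never globally rational on a III curve, so
on the 7 402 reducible shallow-III optimal classes old-toric avoidance can fail only through a purely LOCAL
splitting, as in the irreducible case; the same local lemma is wanted by an's χ₋₃/Kummer-cube certificate
(E-an-55/58) and es's E-es-20 `ManinPrimeToThreeOfReducible` («the 3-isogeny character of a 9 ∥ N curve is
unramified at 3 on the III locus», imc g15 08:46:00Z (a)).

STATUS: a THEOREM-CANDIDATE, not an open problem — refuter-1 §R52: «SURVIVES — TRUE, theorem-grade (elementary)»,
two derivations (Newton polygon of `ψ₃` on the `ℤ₃` Tate-position model: at III one root of valuation `0` +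
three of valuation `1/3` when shallow, none rational when deep; and an's MEMO-an §57.8 LEMMA 1, strict minimum
term), hygiene checked (`D₀ ≠ 0` since an order-`3` point is not `2`-torsion, so no `padicValRat 3 0` junk;
parity of `v₃(D₀)` and the square classes are `[u;r,s,t]`-invariant as `ψ₂` scales by `u³`; the second conjunct
is implied by the first — `v₃(−3D₀)` odd — redundant, harmless); probes 4/4 CLEAN (HOME/ref1-C60P-A-imcg13d-probes.lean
c0e96b4f84c3f9c9).  The proof (an's T-an-20, via the tree's Tate algorithm at `3`,
`Literature/NumberTheory/DiophantineGeometry/TateAlgorithm*`) is PROVER work under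
`Summits/BirchSwinnertonDyer/BirchSwinnertonDyer/Theorems/` and lands `TypeThreeSubgroupCharacterUnramified_holds`
by name; nothing is asserted here.  NOT IN PRINT as stated (refuter-1 §R52: «method known, yes-small if
landed»); nearest print: the III ↔ III* type flip under a `3`-isogeny at a tame potentially supersingular
prime, Dokchitser–Dokchitser, *Local invariants of isogenous elliptic curves* (arXiv:1208.5519) Cor. 8 / Thm. 22
[corpus: paper:arxiv-1208.5519 p0006 L77–84] (= the cell's E-imc-49′), and Tate's algorithm at `3`, Silverman
*ATAEC* IV.9.4, Table 4.1.  Refuter-2 placement R-imc-31/32: not posted at filing.  Beyond-print theorem: no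
(local lemma).  BSD is not proved by this; Manin's conjecture is not proved by this.
-/

namespace Summit.BirchSwinnertonDyer.Rank1Residual.ManinAdditive.TameThreeCharacter

/-- `x₀` is the `x`-coordinate of a ℚ-rational subgroup of order `3` of `W`: a rational root of the
`3`-division polynomial `ψ₃ = 3x⁴ + b₂x³ + 3b₄x² + 3b₆x + b₈`. (imc g13d VERBATIM.) -/
def IsThreeSubgroupX (W : WeierstrassCurve ℚ) (x₀ : ℚ) : Prop :=
  3 * x₀ ^ 4 + W.b₂ * x₀ ^ 3 + 3 * W.b₄ * x₀ ^ 2 + 3 * W.b₆ * x₀ + W.b₈ = 0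

/-- The Kummer discriminant of that subgroup, `D₀ = ψ₂(x₀)² = (2y₀ + a₁x₀ + a₃)²`: the subgroup's points are
defined over `ℚ(√D₀)` and Galois acts on them through `χ_{D₀}`. (imc g13d VERBATIM.) -/
def threeSubgroupDisc (W : WeierstrassCurve ℚ) (x₀ : ℚ) : ℚ :=
  4 * x₀ ^ 3 + W.b₂ * x₀ ^ 2 + 2 * W.b₄ * x₀ + W.b₆

/-- **Candidate E-imc-71 `TypeThreeSubgroupCharacterUnramified` (cell bsd-f2-manin, imc g13d; nothing asserted;
census 8 650 / 8 650): on a global minimal model with `9 ∥ N` and `v₃ Δ_min = 3` (Kodaira III at `3`), a rational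
subgroup of order `3` has character unramified at `3` and is not `μ₃`.** VERBATIM HOME/imc/Sketch-imc-g13d.lean
e99357d621a1a96d `BsdF2ManinImcG13d.TypeThreeSubgroupCharacterUnramified` = refuter-1's row of record
`RefAudit60.TypeThreeSubgroupCharacterUnramified`.  REF1 §R52: SURVIVES — TRUE, theorem-grade (elementary; Newton
polygon of `ψ₃` / an §57.8 Lemma 1), selector `v₃ Δ_min = 3` at `9 ∥ N` = exactly type III (no leak, no guard
needed), hygiene clean, probes 4/4 CLEAN; REF2: pending at filing.  Theorems target: `…_holds` by an's T-an-20
(prover work).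
[cite: SilvermanATAEC1994, IV.9.4 and Table 4.1 (Tate's algorithm at 3, type III) (shape only: the character law for rational 3-subgroups at a type-III prime is the cell's row E-imc-71, NOT in print as stated — MEMO-imc §19.15; nearest print Dokchitser–Dokchitser arXiv:1208.5519 Cor. 8 / Thm. 22, the III ↔ III* flip)] -/
@[conjecture]
def TypeThreeSubgroupCharacterUnramified : Prop :=
  ∀ (W : WeierstrassCurve ℚ) [W.IsElliptic] [W.IsGloballyMinimal],
    3 ^ 2 ∣ W.conductorNorm ℤ → ¬ 3 ^ 3 ∣ W.conductorNorm ℤ → padicValInt 3 W.minimalDiscriminantInt = 3 →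
      ∀ x₀ : ℚ, IsThreeSubgroupX W x₀ →
        Even (padicValRat 3 (threeSubgroupDisc W x₀)) ∧ ¬ IsSquare (-3 * threeSubgroupDisc W x₀)

/-- The character law makes the (OTA₃) danger purely local on the reducible residual: if the rational line of a
III curve were the toric-type line it would be `μ₃` or ramified — excluded by E-imc-71. Recorded as the trivial
implication it is (the content is in the census and in MEMO-imc §19.14). (imc g13d VERBATIM, PROVED.) -/
theorem reducibleShallowIII_rationalLine_not_toric (h : TypeThreeSubgroupCharacterUnramified)
    (W : WeierstrassCurve ℚ) [W.IsElliptic] [W.IsGloballyMinimal]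
    (h9 : 3 ^ 2 ∣ W.conductorNorm ℤ) (h27 : ¬ 3 ^ 3 ∣ W.conductorNorm ℤ)
    (hIII : padicValInt 3 W.minimalDiscriminantInt = 3) (x₀ : ℚ) (hx : IsThreeSubgroupX W x₀) :
    ¬ IsSquare (-3 * threeSubgroupDisc W x₀) :=
  (h W h9 h27 hIII x₀ hx).2

/-! ## T-54b (refuter-1 §R54 gap-fill, imc g15 GO 2026-08-28T09:31:22Z): the `ℚ₃`-LOCAL lines of a
type-III curve — E-imc-76u `TameThreeIIIAtMostOneLocalLine` (LAW, datum-free per refuter-1 T-54a) and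
E-imc-75a₃ `LocallyIrreducibleThreeIffNoLocalLine` (PROVED from the tree, refuter-1 RB62.1)

HONEST FRAMING (second cluster, appended by the cell typer g11; first cluster above byte-identical).
Source rows: HOME/imc/Sketch-imc-g14.lean sha16 **01cd4c12e8478e53** (imc g14, MEMO-imc §20 «LOCAL
REDUCIBILITY LAW», namespace `BsdF2ManinImcG14`): `NoLocalThreeLineAtThree` (:57–59, VERBATIM below) and
`LocallyIrreducibleThreeIffNoLocalLine` (:68–70, E-imc-75a₃); refuter-1 §R54 (HOME/REFUTER-ref1.md
c34cf2807d65dee6, report HOME/ref1/R54-ref1-imcg14.md 2203741908967cef, kernel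
HOME/ref1-C62-imcg14-audit.lean 6afda9362cddf4b4): ALL 11 typed §20 rows SURVIVE, E-imc-75a₃ is a THEOREM in
the tree (RB62.1, from `WeierstrassCurve.hasIrreducibleModPGaloisRep_three_iff_forall_not_isRoot_Ψ₃`,
`Literature/NumberTheory/EllipticCurves/ModThreeReducibleIffPsi3Root.lean`), and ONE GAP-FILL: the untyped
local-uniqueness twin **E-imc-76u** of E-imc-75, «`9 ∥ N`, `v₃ Δ_min = 3` (type III at `3`) ⟹ `Ψ₃` has AT
MOST ONE root in `ℚ₃`», load-bearing for §20.4's plane case (two inertia-isotypic `G_{ℚ₃}`-stable lines of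
`E[3]` would give two `ℚ₃`-roots) and for «`ℓ_can`» being well defined in E-imc-77; refuter-1's signature
(§R54 «GAP-FILL E-imc-76u») typed here DATUM-FREE over `W.conductorNorm ℤ` (T-54a: the `_D :
ModularParametrizationData W N` binder of the §20 rows pins `N` to the conductor only through the Carayol
fact `IsNewformOf.level_eq_conductorNorm`; the `_D` form is a one-line corollary), in the vocabulary of the
first cluster (`IsLocalThreeSubgroupX` = the `ℚ₃`-twin of `IsThreeSubgroupX`, body = imc's quartic VERBATIM).
CENSUS (BC5 witness): refuter-1 engine-2 HOME/ref1/R54-psi3loc.py (+ .out, sha16 in §R54) over ALL Cremona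
curves `N < 5·10⁵` with `9 ∥ N`, `v₃ Δ = 3`: 77 415 curves, `#{ℚ₃-roots of Ψ₃} ∈ {0 (deep) 24 526,
1 (shallow) 52 889}`, **0 curves with ≥ 2 roots**; imc g14 table (optimal only): column «2 stable lines» = 0
on III.  STATUS: a LAW (Katz–Lubin canonical-subgroup prediction, MEMO-imc §20 D6: `w = 2` ⟺ one level-1
canonical subgroup, necessarily `G_{ℚ₃}`-stable; `w ≥ 4` ⟹ all eight 3-division abscissae of valuation
`1/4`, none in `ℚ₃`), NOT in print as stated (refuter-1 §R54; refuter-2 R-imc-32/34 placement pending at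
filing); why it might fail: only through a type-III curve at `3` whose 3-division field has TWO
`G_{ℚ₃}`-stable lines with distinct `ℚ₃`-rational abscissae (E[3]|_I ≅ ω ⊕ 1 with both lines defined over
`ℚ₃`) — excluded in all data.  A proof (expected elementary: Newton polygon of `Ψ₃` on the `ℤ₃`
Tate-position model, one root of valuation `0` + three of valuation `1/3` when shallow) is PROVER work under
`Summits/BirchSwinnertonDyer/BirchSwinnertonDyer/Theorems/` landing `TameThreeIIIAtMostOneLocalLine_holds` by
name; nothing is asserted here.  Also recorded, PROVED: E-imc-75a₃ (refuter-1 RB62.1 VERBATIM up to names),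
refuter-1 RB62.2 («a `Ψ₃`-root is never a `Ψ₂²`-root», tree resultant theorem
`WeierstrassCurve.eval_Ψ₂Sq_ne_zero_of_eval_Ψ₃_eq_zero`), and two one-line edges to the first cluster's rational
vocabulary.  bears_on: crux C3 `ManinPrimeToThreeAtNine` stmt-BirchSwinnertonDyer-22968 (MEMO-imc §20.4,
(OTA₃)).  Beyond-print theorem: no.  BSD is not proved by this; Manin's conjecture is not proved by this. -/

/-- The `3`-division quartic `Ψ₃` of `W` has no root in `ℚ₃`; ⟺ `E[3]` has no `G_{ℚ₃}`-stable line
(E-imc-75a₃ below). (imc g14 VERBATIM, HOME/imc/Sketch-imc-g14.lean :57–59.) -/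
def NoLocalThreeLineAtThree (W : WeierstrassCurve ℚ) : Prop :=
  ∀ x : ℚ_[3], 3 * x ^ 4 + (W.b₂ : ℚ_[3]) * x ^ 3 + 3 * (W.b₄ : ℚ_[3]) * x ^ 2
    + 3 * (W.b₆ : ℚ_[3]) * x + (W.b₈ : ℚ_[3]) ≠ 0

/-- `x` is a `ℚ₃`-rational root of `Ψ₃ = 3x⁴ + b₂x³ + 3b₄x² + 3b₆x + b₈`: the abscissa of a `G_{ℚ₃}`-stable
line of `E[3]` (the `ℚ₃`-twin of `IsThreeSubgroupX`; body = the quartic of imc g14's rows E-imc-76/77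
VERBATIM). -/
def IsLocalThreeSubgroupX (W : WeierstrassCurve ℚ) (x : ℚ_[3]) : Prop :=
  3 * x ^ 4 + (W.b₂ : ℚ_[3]) * x ^ 3 + 3 * (W.b₄ : ℚ_[3]) * x ^ 2 + 3 * (W.b₆ : ℚ_[3]) * x
    + (W.b₈ : ℚ_[3]) = 0

/-- `NoLocalThreeLineAtThree W` says that no `x : ℚ₃` is a local `3`-subgroup abscissa. -/
theorem noLocalThreeLineAtThree_iff (W : WeierstrassCurve ℚ) :
    NoLocalThreeLineAtThree W ↔ ∀ x : ℚ_[3], ¬ IsLocalThreeSubgroupX W x :=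
  Iff.rfl

/-- A rational `3`-subgroup abscissa is a `ℚ₃`-rational one. -/
theorem isLocalThreeSubgroupX_ratCast (W : WeierstrassCurve ℚ) {x₀ : ℚ} (h : IsThreeSubgroupX W x₀) :
    IsLocalThreeSubgroupX W (x₀ : ℚ_[3]) := by
  unfold IsLocalThreeSubgroupX
  unfold IsThreeSubgroupX at h
  exact_mod_cast h

/-- **Candidate E-imc-76u `TameThreeIIIAtMostOneLocalLine` (cell bsd-f2-manin, refuter-1 §R54 gap-fill of
imc g14 MEMO-imc §20.4, imc g15 GO; nothing asserted; census 77 415 / 77 415, 0 curves with two roots): on a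
global minimal model with `9 ∥ N` and `v₃ Δ_min = 3` (Kodaira III at `3`) the `3`-division quartic `Ψ₃` has
AT MOST ONE root in `ℚ₃` — `E[3]` has at most one `G_{ℚ₃}`-stable line.** The `p = 3` twin of E-imc-75
`TameCellAtMostOneLocalTwoTorsionPoint`; refuter-1's signature «`3 ^ 2 ∣ N → ¬ 3 ^ 3 ∣ N → padicValInt 3
W.minimalDiscriminantInt = 3 → ∀ x y : ℚ_[3], P₃ x = 0 → P₃ y = 0 → x = y`» typed DATUM-FREE over
`W.conductorNorm ℤ` (refuter-1 T-54a).  LAW (Katz–Lubin prediction), not in print as stated; REF2 pending.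
Theorems target: `TameThreeIIIAtMostOneLocalLine_holds` (prover work).
[cite: SilvermanATAEC1994, IV.9.4 and Table 4.1 (Tate's algorithm at 3, type III) (shape only: the local-uniqueness law is the cell's row E-imc-76u, NOT in print as stated — MEMO-imc §20.4, refuter-1 §R54)] -/
@[conjecture]
def TameThreeIIIAtMostOneLocalLine : Prop :=
  ∀ (W : WeierstrassCurve ℚ) [W.IsElliptic] [W.IsGloballyMinimal],
    3 ^ 2 ∣ W.conductorNorm ℤ → ¬ 3 ^ 3 ∣ W.conductorNorm ℤ → padicValInt 3 W.minimalDiscriminantInt = 3 →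
      ∀ x y : ℚ_[3], IsLocalThreeSubgroupX W x → IsLocalThreeSubgroupX W y → x = y

/-- Under E-imc-76u a type-III curve at `3` has at most one RATIONAL `3`-subgroup abscissa (the first
cluster's `IsThreeSubgroupX`); one-line edge through `isLocalThreeSubgroupX_ratCast`. (PROVED.) -/
theorem atMostOne_threeSubgroupX_of_tameThreeIIIAtMostOneLocalLine (h : TameThreeIIIAtMostOneLocalLine)
    (W : WeierstrassCurve ℚ) [W.IsElliptic] [W.IsGloballyMinimal]
    (h9 : 3 ^ 2 ∣ W.conductorNorm ℤ) (h27 : ¬ 3 ^ 3 ∣ W.conductorNorm ℤ)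
    (hIII : padicValInt 3 W.minimalDiscriminantInt = 3) {x₀ x₁ : ℚ} (hx₀ : IsThreeSubgroupX W x₀)
    (hx₁ : IsThreeSubgroupX W x₁) : x₀ = x₁ := by
  have := h W h9 h27 hIII _ _ (isLocalThreeSubgroupX_ratCast W hx₀) (isLocalThreeSubgroupX_ratCast W hx₁)
  exact_mod_cast this

/-- Mathlib's `Ψ₃` of `W ⊗ ℚ₃` evaluated at `x : ℚ₃` is imc's quartic (refuter-1 RB62.1 helper, VERBATIM). -/
theorem isRoot_Ψ₃_baseChange_three_iff (W : WeierstrassCurve ℚ) (x : ℚ_[3]) :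
    (W.baseChange ℚ_[3]).Ψ₃.IsRoot x ↔ IsLocalThreeSubgroupX W x := by
  unfold IsLocalThreeSubgroupX
  simp only [Polynomial.IsRoot.def, WeierstrassCurve.Ψ₃, WeierstrassCurve.baseChange,
    WeierstrassCurve.map_b₂, WeierstrassCurve.map_b₄, WeierstrassCurve.map_b₆, WeierstrassCurve.map_b₈,
    eq_ratCast, Polynomial.eval_add, Polynomial.eval_mul, Polynomial.eval_pow, Polynomial.eval_C,
    Polynomial.eval_X, Polynomial.eval_ofNat]

/-- Mathlib's `Ψ₂²` of `W ⊗ ℚ₃` evaluated at `x : ℚ₃` (refuter-1 RB62.2 helper, VERBATIM). -/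
theorem eval_Ψ₂Sq_baseChange_three (W : WeierstrassCurve ℚ) (x : ℚ_[3]) :
    (W.baseChange ℚ_[3]).Ψ₂Sq.eval x =
      4 * x ^ 3 + (W.b₂ : ℚ_[3]) * x ^ 2 + 2 * (W.b₄ : ℚ_[3]) * x + (W.b₆ : ℚ_[3]) := by
  simp only [WeierstrassCurve.Ψ₂Sq, WeierstrassCurve.baseChange,
    WeierstrassCurve.map_b₂, WeierstrassCurve.map_b₄, WeierstrassCurve.map_b₆,
    eq_ratCast, Polynomial.eval_add, Polynomial.eval_mul, Polynomial.eval_pow, Polynomial.eval_C,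
    Polynomial.eval_X, Polynomial.eval_ofNat, map_mul, map_ofNat]

/-- **E-imc-75a₃ `LocallyIrreducibleThreeIffNoLocalLine` holds** (imc g14 SUPPORT row, HOME/imc/Sketch-imc-g14.lean
:68–70; PROVED — refuter-1 RB62.1): `E[3]` is an irreducible `𝔽₃[G_{ℚ₃}]`-module iff `Ψ₃` has no root in
`ℚ₃`, i.e. iff `E[3]` has no `G_{ℚ₃}`-stable line — the tree's general-field equivalence
`WeierstrassCurve.hasIrreducibleModPGaloisRep_three_iff_forall_not_isRoot_Ψ₃` at `K = ℚ₃`.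
[cite: SilvermanAEC2009, III.8 and Ex. 3.7 (division polynomials; a Galois-stable subgroup of order 3 ⟺ a rational root of ψ₃)] -/
theorem hasIrreducibleModPGaloisRep_three_iff_noLocalThreeLineAtThree (W : WeierstrassCurve ℚ)
    [W.IsElliptic] :
    (W.baseChange ℚ_[3]).HasIrreducibleModPGaloisRep 3 ↔ NoLocalThreeLineAtThree W := by
  rw [WeierstrassCurve.hasIrreducibleModPGaloisRep_three_iff_forall_not_isRoot_Ψ₃]
  exact forall_congr' fun x ↦ not_congr (isRoot_Ψ₃_baseChange_three_iff W x)

/-- **A `Ψ₃`-root is never a `Ψ₂²`-root** on an elliptic curve (`Res(Ψ₂², Ψ₃) = −Δ²`; tree theorem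
`WeierstrassCurve.eval_Ψ₂Sq_ne_zero_of_eval_Ψ₃_eq_zero`): the Kummer discriminant `D₀ = Ψ₂²(x)` of a local
`3`-subgroup abscissa is non-zero, so E-imc-77's first conjunct is automatic and `Padic.valuation`'s junk
value at `0` is never read (refuter-1 RB62.2 VERBATIM up to names; PROVED).
[cite: SilvermanAEC2009, III.8 and Ex. 3.7 (division polynomials)] -/
theorem eval_Ψ₂Sq_ne_zero_of_isLocalThreeSubgroupX (W : WeierstrassCurve ℚ) [W.IsElliptic] {x : ℚ_[3]}
    (hx : IsLocalThreeSubgroupX W x) :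
    4 * x ^ 3 + (W.b₂ : ℚ_[3]) * x ^ 2 + 2 * (W.b₄ : ℚ_[3]) * x + (W.b₆ : ℚ_[3]) ≠ 0 := by
  have hΔ : (W.baseChange ℚ_[3]).Δ ≠ 0 := (W.baseChange ℚ_[3]).isUnit_Δ.ne_zero
  have h3 : (W.baseChange ℚ_[3]).Ψ₃.eval x = 0 := (isRoot_Ψ₃_baseChange_three_iff W x).mpr hx
  rw [← eval_Ψ₂Sq_baseChange_three]
  exact (W.baseChange ℚ_[3]).eval_Ψ₂Sq_ne_zero_of_eval_Ψ₃_eq_zero hΔ h3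

/-- On the reducible residual (a RATIONAL `3`-subgroup abscissa `x₀`) the curve is locally reducible at `3`:
`¬ NoLocalThreeLineAtThree W`, equivalently `E[3] ⊗ ℚ₃` is a reducible Galois module (one-line edge; PROVED). -/
theorem not_noLocalThreeLineAtThree_of_isThreeSubgroupX (W : WeierstrassCurve ℚ) {x₀ : ℚ}
    (h : IsThreeSubgroupX W x₀) : ¬ NoLocalThreeLineAtThree W :=
  fun hno ↦ hno (x₀ : ℚ_[3]) (isLocalThreeSubgroupX_ratCast W h)

/-! ## T-54c (third cluster, cell typer g12; first two clusters byte-identical): E-imc-76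
`TameThreeIIIShallowIffLocalLine` and E-imc-77 `TameThreeIIICanonicalLineUnramified` DATUM-FREE, with the
selector `DeepIII` — typed because both rows SURVIVED refuter-1 §R54 (R-imc-31/32; HOME/ref1/R54-ref1-imcg14.md
2203741908967cef; kernel HOME/ref1-C62-imcg14-audit.lean 6afda9362cddf4b4 rc 0 · 0/0/0; probes 12/12 CLEAN) and are
PROVED in the tree in exactly this datum-free form (bsd-line-manin23-p2 g7, p628327
`Theorems/ManinLocalTwoThreeTameThreeLocalLineLaws.lean`: `tameThreeIII_localLine_iff_shallow`,
`tameThreeIII_canonicalLine_unramified`; typing note INBOX 2026-08-28T11:18:20Z «type 76/77 DATUM-FREE over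
W.conductorNorm ℤ like 71/76u (refuter-1 T-54a); `DeepIII` unfolded as …»).  Source rows: HOME/imc/Sketch-imc-g14.lean
sha16 **01cd4c12e8478e53** :179–208 (imc g14, MEMO-imc §19.11/§20.4), bodies VERBATIM with the unused binder
`(_D : ModularParametrizationData W N)` and the level `N` replaced by `W.conductorNorm ℤ` (T-54a: the datum pins `N`
to the conductor only through Carayol), and the `Ψ₃`-root hypothesis of E-imc-77 spelled `IsLocalThreeSubgroupX W x`
(second cluster; definitionally imc's quartic).  CENSUS (BC5): imc g14-psi3.out (type-III optimal at `9 ∥ N`,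
`N < 5·10⁵`): shallow ⟹ exactly one `ℚ₃`-root 38 145 / 38 145, deep ⟹ none 17 577 / 17 577; E-imc-77: `v₃(D₀)` even
38 145 / 38 145 (ψ_can trivial 19 798, unramified quadratic 18 347, ramified **0**); refuter-1 engine 2
(R54-psi3loc-all.out d4155b992bcc8733) ALL 77 415 type-III curves: `(#ℚ₃-roots, DeepIII) ∈ {(0, deep) 24 526,
(1, shallow) 52 889}`, 0 exceptions, and `v₃(D₀(x_can)) = 0` exactly on 52 889 / 52 889.  STATUS at filing: both rows
are THEOREMS in the tree (p628327); the `@[conjecture]` tag records them as the cell's named rows, the by-name closers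
`TameThreeIIIShallowIffLocalLine_holds` / `TameThreeIIICanonicalLineUnramified_holds` are one-liners over p2's
declarations (sibling `TypeThreeSubgroupCharacterHolds.lean`).  PLACEMENT: Katz–Lubin canonical-subgroup prediction
(MEMO-imc §20 D6) made explicit on Tate's type III; not in print as stated (refuter-1 §R54; refuter-2 R-imc-32/34
pending).  bears_on: crux C3 `ManinPrimeToThreeAtNine` stmt-BirchSwinnertonDyer-22968 ((OTA₃), MEMO-imc §20.4; es
E-es-20).  Beyond-print theorem: no.  BSD is not proved by this; Manin's conjecture is not proved by this. -/

/-- **«Deep» type III at `3`** (imc g13b/g14 selector `DeepIII`, VERBATIM HOME/imc/Sketch-imc-g14.lean :179–180):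
`9 ∣ b₂ − 12 b₆` on the (global minimal) model, `v₃ = ∞` allowed.  On a type-III curve at `3` (`9 ∥ N`,
`v₃ Δ_min = 3`) «deep» ⟺ `Ψ₃` has NO root in `ℚ₃` (E-imc-76); «shallow» = `¬ DeepIII`. -/
def DeepIII (W : WeierstrassCurve ℚ) : Prop :=
  W.b₂ - 12 * W.b₆ = 0 ∨ 2 ≤ padicValRat 3 (W.b₂ - 12 * W.b₆)

/-- **Candidate E-imc-76 `TameThreeIIIShallowIffLocalLine` (cell bsd-f2-manin, imc g14 MEMO-imc §19.11/§20.4;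
DATUM-FREE per refuter-1 T-54a; nothing asserted by the tag — PROVED in the tree, p628327
`…Theorems.ManinLocalTwoThree.tameThreeIII_localLine_iff_shallow`):** on a global minimal model with `9 ∥ N` and
`v₃ Δ_min = 3` (Kodaira III at `3`), `E[3]` has a `G_{ℚ₃}`-stable line (`Ψ₃` has a root in `ℚ₃`) iff the curve is
SHALLOW (`9 ∤ b₂ − 12 b₆`).  Predicted by Katz–Lubin (MEMO-imc §20 D6): `w = 2` ⟺ a level-1 canonical subgroup with
`ℚ₃^nr(3^{1/4})`-points, necessarily `G_{ℚ₃}`-stable; `w ≥ 4` ⟹ all eight 3-division abscissae have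
`v₃(x − r₀) = 1/4`.  Census: shallow 38 145 / 38 145 one root, deep 17 577 / 17 577 none (optimal); all curves 77 415,
0 exceptions (refuter-1 engine 2).  REF1 §R54: **SURVIVES** (LAW; `DeepIII` model-independent on minimal models).
(imc g14 VERBATIM :187–191 with `_D`/`N` ↦ `W.conductorNorm ℤ`.)
[cite: SilvermanATAEC1994, IV.9.4 and Table 4.1 (Tate's algorithm at 3, type III) (shape only: the shallow/deep ⟺ local-line law is the cell's row E-imc-76, NOT in print as stated — MEMO-imc §20.4, refuter-1 §R54)] -/
@[conjecture]
def TameThreeIIIShallowIffLocalLine : Prop :=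
  ∀ (W : WeierstrassCurve ℚ) [W.IsElliptic] [W.IsGloballyMinimal],
    3 ^ 2 ∣ W.conductorNorm ℤ → ¬ 3 ^ 3 ∣ W.conductorNorm ℤ → padicValInt 3 W.minimalDiscriminantInt = 3 →
      (¬ NoLocalThreeLineAtThree W ↔ ¬ DeepIII W)

/-- **Candidate E-imc-77 `TameThreeIIICanonicalLineUnramified` (cell bsd-f2-manin, imc g14 MEMO-imc §20.4; LAW, new
as a statement; DATUM-FREE per refuter-1 T-54a; nothing asserted by the tag — PROVED in the tree, p628327
`…Theorems.ManinLocalTwoThree.tameThreeIII_canonicalLine_unramified`):** on a global minimal model with `9 ∥ N` and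
`v₃ Δ_min = 3`, at every `ℚ₃`-root `x_can` of `Ψ₃` (the canonical `G_{ℚ₃}`-stable line of a shallow-III curve) the
Kummer discriminant `D₀ = 4x³ + b₂x² + 2b₄x + b₆` is non-zero with EVEN `3`-adic valuation (indeed `0`): the
character `χ_{D₀}` of the canonical line is UNRAMIFIED at `3` — trivial (a `ℚ₃`-rational point of order 3) or the
unramified quadratic one.  Consequence for (OTA₃) (MEMO-imc §20.4): `E_f[3] ∩ T[3]` can only lie in the
inertia-TRIVIAL part of `T[3] = Hom(X(T), μ₃)`, i.e. the `χ₋₃`-twisted 9-new Steinberg packet; the 3-old Steinberg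
packet (inertia `ω`) never meets `E_f[3]` on R-III.  Census: 38 145 / 38 145 shallow-III optimal (trivial 19 798,
unramified quadratic 18 347, ramified 0); all curves: `v₃(D₀(x_can)) = 0` exactly on 52 889 / 52 889 (refuter-1
engine 2).  REF1 §R54: **SURVIVES** (LAW, sharper in data; first conjunct automatic by
`eval_Ψ₂Sq_ne_zero_of_isLocalThreeSubgroupX`, second cluster).  (imc g14 VERBATIM :200–208 with `_D`/`N` ↦
`W.conductorNorm ℤ` and the root hypothesis spelled `IsLocalThreeSubgroupX W x`, definitionally imc's quartic.)
[cite: SilvermanATAEC1994, IV.9.4 and Table 4.1 (shape only: the unramified-character law is the cell's row E-imc-77, NOT in print as stated — MEMO-imc §20.4, refuter-1 §R54)] -/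
@[conjecture]
def TameThreeIIICanonicalLineUnramified : Prop :=
  ∀ (W : WeierstrassCurve ℚ) [W.IsElliptic] [W.IsGloballyMinimal],
    3 ^ 2 ∣ W.conductorNorm ℤ → ¬ 3 ^ 3 ∣ W.conductorNorm ℤ → padicValInt 3 W.minimalDiscriminantInt = 3 →
      ∀ x : ℚ_[3], IsLocalThreeSubgroupX W x →
        4 * x ^ 3 + (W.b₂ : ℚ_[3]) * x ^ 2 + 2 * (W.b₄ : ℚ_[3]) * x + (W.b₆ : ℚ_[3]) ≠ 0 ∧
        Even (Padic.valuation
          (4 * x ^ 3 + (W.b₂ : ℚ_[3]) * x ^ 2 + 2 * (W.b₄ : ℚ_[3]) * x + (W.b₆ : ℚ_[3])))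

/-- Consumer shape of E-imc-76, deep direction: a DEEP type-III curve at `3` has NO `G_{ℚ₃}`-stable line
(es E-es-20 / E-imc-78: deep III is locally irreducible at `3`). (PROVED edge.) -/
theorem noLocalThreeLineAtThree_of_deepIII (h : TameThreeIIIShallowIffLocalLine) (W : WeierstrassCurve ℚ)
    [W.IsElliptic] [W.IsGloballyMinimal] (h9 : 3 ^ 2 ∣ W.conductorNorm ℤ) (h27 : ¬ 3 ^ 3 ∣ W.conductorNorm ℤ)
    (hIII : padicValInt 3 W.minimalDiscriminantInt = 3) (hd : DeepIII W) : NoLocalThreeLineAtThree W :=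
  not_not.mp fun hno ↦ (h W h9 h27 hIII).mp hno hd

/-- Consumer shape of E-imc-76, shallow direction: a SHALLOW type-III curve at `3` HAS a `G_{ℚ₃}`-stable line
(a `ℚ₃`-root of `Ψ₃`; unique by E-imc-76u). (PROVED edge.) -/
theorem exists_isLocalThreeSubgroupX_of_shallow (h : TameThreeIIIShallowIffLocalLine) (W : WeierstrassCurve ℚ)
    [W.IsElliptic] [W.IsGloballyMinimal] (h9 : 3 ^ 2 ∣ W.conductorNorm ℤ) (h27 : ¬ 3 ^ 3 ∣ W.conductorNorm ℤ)
    (hIII : padicValInt 3 W.minimalDiscriminantInt = 3) (hs : ¬ DeepIII W) : ∃ x : ℚ_[3], IsLocalThreeSubgroupX W x := by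
  have hno : ¬ NoLocalThreeLineAtThree W := (h W h9 h27 hIII).mpr hs
  rw [noLocalThreeLineAtThree_iff] at hno
  push Not at hno
  exact hno

/-- Deep type III at `3` ⟹ `E[3] ⊗ ℚ₃` is an irreducible Galois module (E-imc-76 with E-imc-75a₃). (PROVED edge.) -/
theorem hasIrreducibleModPGaloisRep_three_of_deepIII (h : TameThreeIIIShallowIffLocalLine)
    (W : WeierstrassCurve ℚ) [W.IsElliptic] [W.IsGloballyMinimal] (h9 : 3 ^ 2 ∣ W.conductorNorm ℤ)
    (h27 : ¬ 3 ^ 3 ∣ W.conductorNorm ℤ) (hIII : padicValInt 3 W.minimalDiscriminantInt = 3) (hd : DeepIII W) :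
    (W.baseChange ℚ_[3]).HasIrreducibleModPGaloisRep 3 :=
  (hasIrreducibleModPGaloisRep_three_iff_noLocalThreeLineAtThree W).mpr
    (noLocalThreeLineAtThree_of_deepIII h W h9 h27 hIII hd)

/-- A rational `3`-subgroup (the first cluster's `IsThreeSubgroupX`) on a type-III curve forces SHALLOW (E-imc-76,
contrapositive of the deep direction). (PROVED edge.) -/
theorem not_deepIII_of_isThreeSubgroupX (h : TameThreeIIIShallowIffLocalLine) (W : WeierstrassCurve ℚ)
    [W.IsElliptic] [W.IsGloballyMinimal] (h9 : 3 ^ 2 ∣ W.conductorNorm ℤ) (h27 : ¬ 3 ^ 3 ∣ W.conductorNorm ℤ)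
    (hIII : padicValInt 3 W.minimalDiscriminantInt = 3) {x₀ : ℚ} (hx : IsThreeSubgroupX W x₀) : ¬ DeepIII W :=
  (h W h9 h27 hIII).mp (not_noLocalThreeLineAtThree_of_isThreeSubgroupX W hx)

end Summit.BirchSwinnertonDyer.Rank1Residual.ManinAdditive.TameThreeCharacter
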